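import Mathlib
import Literature.NumberTheory.LFunctions.MultiplicativeAutomatic

/-!
# A `k^p`-automatic sequence is `k`-automatic (stub `isAutomaticSeq_of_isAutomaticSeq_pow`, line Sketch)

Support file for the crux `Summit.QuantumAdvantage.QuantumAdvantage.Theses.MobiusLadder.DigitPolyUniformity`
(item `stmt-QuantumAdvantage-1392`), automatic-phase class. Block-diagonal digit phases are
naturally `2^b`-automatic; to feed them into the tree's `2`-automatic pipeline we need the easy
half of Cobham's theorem for the multiplicatively dependent bases `k` and `k^p`: in the kernel
sense of `Literature.NumberTheory.LFunctions.IsAutomaticSeq` (finite `q`-kernel), a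
`k^p`-automatic sequence is `k`-automatic (the converse of
`Literature.NumberTheory.LFunctions.IsAutomaticSeq.pow`).

Proof: a `k`-kernel element `g = (a(k^i n + r))_n` (`i ≥ 1`, `r < k^i`) is an interleaving, along
the residues `s` modulo `k^t` with `i + t = p u`, `u ≥ 1`, `t < p`, of the `k^p`-kernel elements
`h_s = (a((k^p)^u m + (k^i s + r)))_m`: indeed `g(k^t m + s) = h_s(m)` and
`k^i s + r < k^i k^t = (k^p)^u`. Hence the `k`-kernel lies in the union over `t < p` of the
images of the finite sets of maps `Fin (k^t) → K_{k^p}(a)`, a finite set.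
-/

set_option linter.dupNamespace false -- D-0017: single-problem summit ⇒ QuantumAdvantage.QuantumAdvantage by design

namespace Summit.QuantumAdvantage.QuantumAdvantage.Theorems.MobiusLadder

namespace AutomaticOfPow

open Literature.NumberTheory.LFunctions

/-- **Ceiling division**: for `p ≥ 1` every `i ≥ 1` is at distance `< p` below a positive
multiple `p u` of `p` (`u = ⌈i/p⌉`). [folklore] -/
theorem exists_add_eq_mul {i p : ℕ} (hi : 1 ≤ i) (hp : 1 ≤ p) :
    ∃ u t : ℕ, 1 ≤ u ∧ t < p ∧ i + t = p * u := by
  have h1 : p * ((i + p - 1) / p) + (i + p - 1) % p = i + p - 1 := Nat.div_add_mod _ _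
  have h2 : (i + p - 1) % p < p := Nat.mod_lt _ (by omega)
  generalize (i + p - 1) / p = u at h1
  generalize (i + p - 1) % p = m at h1 h2
  have hu : 1 ≤ u := Nat.pos_of_ne_zero (by rintro rfl; rw [mul_zero] at h1; omega)
  exact ⟨u, p * u - i, hu, by omega, by omega⟩

/-- **Interleaving**: every `k`-kernel element `(a(k^i n + r))_n` of `a` (`i ≥ 1`, `r < k^i`) is,
for some `t < p`, the interleaving along the residues modulo `k^t` of `k^t` elements of the
`k^p`-kernel of `a`; so the `k`-kernel of `a` is contained in the union over `t < p` of the ranges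
of the interleaving maps `(Fin (k^t) → K_{k^p}(a)) → (ℕ → ℂ)`. [folklore] -/
theorem qKernel_subset_iUnion {k p : ℕ} (hk : 2 ≤ k) (hp : 1 ≤ p) (a : ℕ → ℂ) :
    qKernel k a ⊆ ⋃ t ∈ Set.Iio p, Set.range (fun H : Fin (k ^ t) → ↥(qKernel (k ^ p) a) =>
      fun n => (H ⟨n % k ^ t, Nat.mod_lt _ (pow_pos (by omega) t)⟩ : ℕ → ℂ) (n / k ^ t)) := by
  rintro g ⟨i, hi, r, hr, rfl⟩
  obtain ⟨u, t, hu, ht, hiu⟩ := exists_add_eq_mul hi hp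
  have hpow : k ^ i * k ^ t = (k ^ p) ^ u := by rw [← pow_add, hiu, pow_mul]
  refine Set.mem_iUnion₂.2 ⟨t, Set.mem_Iio.2 ht, ?_⟩
  refine ⟨fun s => ⟨fun m => a ((k ^ p) ^ u * m + (k ^ i * (s : ℕ) + r)),
    u, hu, k ^ i * (s : ℕ) + r, ?_, rfl⟩, ?_⟩
  · calc k ^ i * (s : ℕ) + r < k ^ i * (s : ℕ) + k ^ i := by omega
      _ = k ^ i * ((s : ℕ) + 1) := by ring
      _ ≤ k ^ i * k ^ t := Nat.mul_le_mul_left _ s.isLt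
      _ = (k ^ p) ^ u := hpow
  · funext n
    show a ((k ^ p) ^ u * (n / k ^ t) + (k ^ i * (n % k ^ t) + r)) = a (k ^ i * n + r)
    congr 1
    rw [← hpow]
    calc k ^ i * k ^ t * (n / k ^ t) + (k ^ i * (n % k ^ t) + r)
        = k ^ i * (k ^ t * (n / k ^ t) + n % k ^ t) + r := by ring
      _ = k ^ i * n + r := by rw [Nat.div_add_mod]

end AutomaticOfPow

/-- **A `k^p`-automatic sequence is `k`-automatic** (`k ≥ 2`, `p ≥ 1`; the easy half of Cobham's
theorem for the multiplicatively dependent bases `k`, `k^p`, converse to `IsAutomaticSeq.pow`):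
every `k`-kernel element of `a` is an interleaving modulo some `k^t`, `t < p`, of `k^p`-kernel
elements, so a finite `k^p`-kernel forces a finite `k`-kernel. [folklore] -/
theorem isAutomaticSeq_of_isAutomaticSeq_pow : ∀ k p : ℕ, 2 ≤ k → 1 ≤ p → ∀ a : ℕ → ℂ, Literature.NumberTheory.LFunctions.IsAutomaticSeq (k ^ p) a → Literature.NumberTheory.LFunctions.IsAutomaticSeq k a := by
  intro k p hk hp a ha
  haveI : Finite ↥(Literature.NumberTheory.LFunctions.qKernel (k ^ p) a) := ha.to_subtype
  refine Set.Finite.subset ?_ (AutomaticOfPow.qKernel_subset_iUnion hk hp a)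
  exact Set.Finite.biUnion (Set.finite_Iio p) fun t _ => Set.finite_range _

end Summit.QuantumAdvantage.QuantumAdvantage.Theorems.MobiusLadder
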